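import Summits.QuantumFields.BalabanUV.Beta.GAN24.ContactGaugeStaircaseCauchyPack
import Summits.QuantumFields.BalabanUV.Beta.GAN24.StaircasePairing

/-!
# `BalabanUV.Beta.GAN24.ContactGaugeRefine` — binder row G-an2-4 / (CONV-C), the row owner's CONTACT-TERM ROUTE, step CT-4c (`gen19/CT4-DESIGN-v0.md` §2 (α)+(δ)),
# **THE BOND GAUGE FUNCTION OF THE TALLER TOWER AT A FINE′ SITE AGAINST THE SHORTER TOWER's AT ITS CELL — ONE POINTWISE LETTER, ONE RATE**
# (gan24-p2 g34's CT-4b `(k+2)`-staircase `gauge_refine_eq_staircase` ∕ `ContactGaugeStaircaseCauchyPack.exists_gauge_staircase_cauchy` SUMMED over the scales)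

NOT IN PRINT; OUR BOOKKEEPING (G-an2-4 formalisation swarm, leaf prover `b2b-balaban-gan24-formalise-leaf-01`, gen 61; the task NAMED by the CT-4c holder leaf-02 g50,
W-leaf02-g50-1 journal l.35605 — «the εw∕εψ SITE letter = (α)+(δ) SUMMED over p2 g34's `gauge_refine_eq_staircase` pieces … the `hdψ` ∕ `hdW` slot of my tip∕mid∕site ENDs
in native currency»; «MINE (εψ SITE LETTER)» l.35663).  HONEST FRAMING (cell contract, verbatim): «discharging `BetaPertH` makes Bałaban's UV stability UNCONDITIONAL —
a real constructive-QFT result; it is NOT the continuum limit and NOT the Clay problem.»  HONEST DEPENDENCY (verbatim): «continuum YM on T⁴ ⇐ BetaPertH ∧ nine spine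
estimates (0/9 proved); BetaPertH ⇐ (D1) ∧ (D4) ∧ CAP+tail; G-an2-4 gates asym, D1 and NE2/3/4.»

WHAT (`d = 3`, `m = 0`, in-block root `ρ = toSite rr`, every `Lc ≥ 2`; `λ_k u := Psi ρ Lc 0 k (delta1 μ z) u − bmGaugeAt ρ (respStep 1 (Lc^(k+1)) μ z) Lc u` the bond
gauge function of member `k`'s dressed composite leg, `ContactKernelCells` §1):
* §1 `sum_pieceLetters_le` (bookkeeping): `Σ_{s′<k+2} (if s′ = 0 then A else B·Lc^{s′}) ≤ A + 2·B·Lc^{k+1}` (`B ≥ 0`, `Lc ≥ 2`; the owner's `StaircasePairing.sum_pow_le`).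
* §2 **`abs_gauge_refine_site_le`** (PARAMETRIC in leaf-12's (N1) data `C, κ₀` and the owner's CT-4a data `c, θ, κ₁`, at any common rate `κ ≤ min κ₀ κ₁` — so that CT-4e
  shares ONE (N1)∕CT-4a instance across the three cells, leaf-02 g50 W-leaf02-g50-4) and its packaged twin **`exists_gauge_refine_site_three (hLc : 2 ≤ Lc)`**: CT-4a's `c, θ` and leaf-12's (N1) `C` at ONE rate `κ > 0` (gan24-p2's Pack) with, for ALL in-block roots, ALL `k μ z`
  and ALL fine′ sites `u′` of member `k+1`,
  `|λ_{k+1} u′ − (Lc^4)⁻¹·λ_k (blk Lc u′)| ≤ (16·Lc·c·θ^k·(Lc^{5(k+2)})⁻¹·Lc^{k+1} + 8·Lc·C·(Lc^{5(k+2)})⁻¹)·e^{−κ‖quo (Lc^(k+2)) u′ − z‖∞}`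
  — the paired scales `1 ≤ s′ ≤ k+1` give `θ^k ×` twice the top amplitude (geometric sum), the unpaired finest piece `s′ = 0` gives the undifferenced amplitude at scale `0`
  (in units `N′^4 ×`: `16·c·θ^k + 8·C·Lc^{−(k+1)}` — (α) θ-small, (δ) `1∕N`-small).  This is the `hdψ`∕`hdW` POINTWISE letter of leaf-02 g50's `ContactCellRefine.abs_refine3_le` ∕
  `ContactCellRefineTip.abs_refine3_tip_le` for SITE weights, in native currency.
[folklore] throughout: gan24-p2 g34's Pack END BY NAME + one geometric sum; 0 `def`, 0 cited facts, 0 `def … : Prop`, 0 sorry.  NO estimate of Bałaban's; discharges NOTHING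
of hSdev ∕ (hS, hSall) by itself; 0 wall binders; NEVER «G-an2-4 closed»; NOT D1, NOT BetaPertH, NOT continuum, NOT Clay.
-/

noncomputable section

open Finset
open scoped BigOperators
open Literature.MathematicalPhysics.QuantumFieldTheory
open Literature.MathematicalPhysics.QuantumFieldTheory.LatticeForm (quo)
open Literature.MathematicalPhysics.QuantumFieldTheory.Balaban1983to89
open Literature.MathematicalPhysics.QuantumFieldTheory.Balaban1983to89.Beta
open B4ContourShift (supNorm supNorm_nonneg)
open AffineAveraging (Site box toSite)
open AveragingContours (blk)
open KKTFluctuationKernel (delta1)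
open BalabanCompositeJets (respStep)
open Summit.QuantumFields.BalabanUV.Beta.AxialProjectorBlockMean (bmGaugeAt)
open Summit.QuantumFields.BalabanUV.Beta.GAN24.RespStepBmDecompLegs (legAct)
open Summit.QuantumFields.BalabanUV.Beta.GAN24.RespStepBmDecompPsi (Psi)
open Summit.QuantumFields.BalabanUV.Beta.GAN24.StaircasePairing (sum_pow_le)
open Summit.QuantumFields.BalabanUV.Beta.GAN24.ContactGaugeStaircaseCauchy (gauge_refine_eq_staircase abs_gaugePieceDiff_le abs_gaugePieceDiff_zero_le
  exp_env_mono)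

namespace Summit.QuantumFields.BalabanUV.Beta.GAN24.ContactGaugeRefine

variable {Lc : ℕ} [NeZero Lc]

/-! ## §1 Bookkeeping: the sum of the `k+2` piece letters -/

omit [NeZero Lc] in
/-- [folklore] **THE SUM OF THE PIECE LETTERS**: `Σ_{s′<k+2} (if s′ = 0 then A else B·Lc^{s′}) ≤ A + 2·B·Lc^{k+1}` for `B ≥ 0`, `Lc ≥ 2`
(`Σ_{1 ≤ s′ ≤ k+1} Lc^{s′} = Lc·Σ_{s<k+1} Lc^s ≤ 2·Lc^{k+1}`, the owner's `StaircasePairing.sum_pow_le`). -/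
theorem sum_pieceLetters_le (hLc : 2 ≤ Lc) (A : ℝ) {B : ℝ} (hB : 0 ≤ B) (k : ℕ) :
    ∑ s' ∈ Finset.range (k + 2), (if s' = 0 then A else B * (Lc : ℝ) ^ s') ≤ A + 2 * B * (Lc : ℝ) ^ (k + 1) := by
  have hL : (2 : ℝ) ≤ (Lc : ℝ) := by exact_mod_cast hLc
  have hL0 : (0 : ℝ) ≤ (Lc : ℝ) := by linarith
  rw [Finset.sum_range_succ']
  simp only [Nat.succ_ne_zero, if_false, if_true]
  have hs : ∑ s ∈ Finset.range (k + 1), B * (Lc : ℝ) ^ (s + 1) = B * (Lc : ℝ) * ∑ s ∈ Finset.range (k + 1), (Lc : ℝ) ^ s := by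
    rw [Finset.mul_sum]
    exact Finset.sum_congr rfl fun s _ => by rw [pow_succ]; ring
  rw [hs]
  have h := sum_pow_le hL k
  have h2 : B * (Lc : ℝ) * ∑ s ∈ Finset.range (k + 1), (Lc : ℝ) ^ s ≤ B * (Lc : ℝ) * (2 * (Lc : ℝ) ^ k) :=
    mul_le_mul_of_nonneg_left h (mul_nonneg hB hL0)
  have e : B * (Lc : ℝ) * (2 * (Lc : ℝ) ^ k) = 2 * B * (Lc : ℝ) ^ (k + 1) := by rw [pow_succ]; ring
  linarith

/-! ## §2 `d = 3`: the pointwise site letter at one rate -/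

/-- NOT IN PRINT; OUR BOOKKEEPING.  **THE SITE LETTER, PARAMETRIC** (`d = 3`, `m = 0`, in-block root `ρ = toSite rr`; leaf-12's (N1) data `C, κ₀` and the owner's CT-4a
data `c, θ, κ₁` exactly as `ContactGaugeStaircase.abs_gaugePiece_le` ∕ `RespStepCauchy.exists_respStep_cauchy` print them; any common rate `0 ≤ κ ≤ min κ₀ κ₁`): for ALL `k μ z`
and ALL fine′ sites `u′`,
`|λ_{k+1} u′ − (Lc^4)⁻¹·λ_k (blk Lc u′)| ≤ (16·Lc·c·θ^k·(Lc^{5(k+2)})⁻¹·Lc^{k+1} + 8·Lc·C·(Lc^{5(k+2)})⁻¹)·e^{−κ‖quo (Lc^(k+2)) u′ − z‖∞}`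
(gan24-p2 g34's `gauge_refine_eq_staircase` + `abs_gaugePieceDiff_le` ∕ `_zero_le` BY NAME, rates weakened to `κ` by `exp_env_mono`, the scales summed by §1). -/
theorem abs_gauge_refine_site_le (hLc : 2 ≤ Lc) {κ₀ C c θ κ₁ κ : ℝ} (hC : 0 ≤ C) (hc : 0 ≤ c) (hθ : 0 ≤ θ) (hκ0 : κ ≤ κ₀) (hκ1 : κ ≤ κ₁)
    (hN1 : ∀ (m k : ℕ) (μ : Fin (3 + 1)) (z : Site (3 + 1)) (l'' : Fin (3 + 1)) (w' : Site (3 + 1)),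
      |respStep (d := 3) (Lc ^ m) (Lc ^ (m + k + 1)) μ z l'' w'| ≤
        C * ((Lc : ℝ) ^ (5 * (k + 1)))⁻¹ * Real.exp (-(κ₀ * supNorm (quo (Lc ^ (k + 1)) w' - z))))
    (hCau : ∀ (s k : ℕ) (μ : Fin (3 + 1)) (z : Site (3 + 1)) (l : Fin (3 + 1)) (w : Site (3 + 1)),
      |respStep (d := 3) (Lc ^ (s + 1)) (Lc ^ (s + k + 2)) μ z l w - respStep (d := 3) (Lc ^ s) (Lc ^ (s + k + 1)) μ z l w|
        ≤ c * θ ^ (s + k) * ((((Lc ^ (k + 1) : ℕ) : ℝ)) ^ (3 + 2))⁻¹ * Real.exp (-(κ₁ * supNorm (quo (Lc ^ (k + 1)) w - z))))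
    {rr : Fin (3 + 1) → ℕ} (hrr : rr ∈ box (3 + 1) Lc) (k : ℕ) (μ : Fin (3 + 1)) (z u' : Site (3 + 1)) :
    |(Psi (toSite rr) Lc 0 (k + 1) (delta1 μ z) u' - bmGaugeAt (toSite rr) (respStep (d := 3) 1 (Lc ^ (k + 2)) μ z) Lc u')
        - ((Lc : ℝ) ^ (3 + 1))⁻¹ *
          (Psi (toSite rr) Lc 0 k (delta1 μ z) (blk Lc u')
            - bmGaugeAt (toSite rr) (respStep (d := 3) 1 (Lc ^ (k + 1)) μ z) Lc (blk Lc u'))|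
      ≤ (16 * (Lc : ℝ) * c * θ ^ k * ((Lc : ℝ) ^ (5 * (k + 2)))⁻¹ * (Lc : ℝ) ^ (k + 1)
          + 8 * (Lc : ℝ) * C * ((Lc : ℝ) ^ (5 * (k + 2)))⁻¹) *
        Real.exp (-(κ * supNorm (quo (Lc ^ (k + 2)) u' - z))) := by
  rw [gauge_refine_eq_staircase (toSite rr) k μ z u']
  refine (Finset.abs_sum_le_sum_abs _ _).trans ?_
  have hmono : ∀ s' ∈ Finset.range (k + 2),
      |(fun (s' : ℕ) (y : Site (3 + 1)) =>
          if s' = 0 then -bmGaugeAt (toSite rr) (legAct (respStep (d := 3) 1 (Lc ^ (k + 2))) (delta1 μ z)) Lc y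
          else -(((Lc : ℝ) ^ ((3 + 1) * s'))⁻¹ *
            bmGaugeAt (toSite rr) (legAct (respStep (d := 3) (Lc ^ s') (Lc ^ (k + 2))) (delta1 μ z)
              - legAct (respStep (d := 3) (Lc ^ (s' - 1)) (Lc ^ (k + 1))) (delta1 μ z)) Lc y)) s' (blk (Lc ^ s') u')|
        ≤ (if s' = 0 then 8 * (Lc : ℝ) * C * ((Lc : ℝ) ^ (5 * (k + 2)))⁻¹
            else 8 * (Lc : ℝ) * (c * θ ^ k) * ((Lc : ℝ) ^ (5 * (k + 2)))⁻¹ * (Lc : ℝ) ^ s') *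
          Real.exp (-(κ * supNorm (quo (Lc ^ (k + 2)) u' - z))) := by
    intro s' hs'
    have hs : s' ≤ k + 1 := by have h := Finset.mem_range.1 hs'; omega
    rcases Nat.eq_zero_or_pos s' with h0 | hpos
    · subst h0
      rw [if_pos rfl]
      refine (abs_gaugePieceDiff_zero_le hN1 hrr k μ z u').trans ?_
      exact mul_le_mul_of_nonneg_left (exp_env_mono hκ0 (supNorm_nonneg _)) (by positivity)
    · rw [if_neg (by omega)]
      refine (abs_gaugePieceDiff_le hCau hrr k μ z hpos hs u').trans ?_
      exact mul_le_mul_of_nonneg_left (exp_env_mono hκ1 (supNorm_nonneg _)) (by positivity)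
  refine (Finset.sum_le_sum hmono).trans ?_
  rw [← Finset.sum_mul]
  have hB : 0 ≤ 8 * (Lc : ℝ) * (c * θ ^ k) * ((Lc : ℝ) ^ (5 * (k + 2)))⁻¹ := by positivity
  refine (mul_le_mul_of_nonneg_right (sum_pieceLetters_le hLc (8 * (Lc : ℝ) * C * ((Lc : ℝ) ^ (5 * (k + 2)))⁻¹) hB k)
    (Real.exp_pos _).le).trans (le_of_eq ?_)
  ring

/-- NOT IN PRINT; OUR BOOKKEEPING ([folklore] packaging of gan24-p2 g34's `ContactGaugeStaircaseCauchyPack.exists_gauge_staircase_cauchy` BY NAME, summed over the scales).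
**THE BOND GAUGE FUNCTIONS OF TWO CONSECUTIVE MEMBERS, TOP-ALIGNED, AGREE POINTWISE ON THE CELLS UP TO `θ^k + Lc^{−(k+1)}` (in units)** (`d = 3`, `m = 0`, every `Lc ≥ 2`,
every in-block root): ONE rate `κ > 0`, CT-4a's `c ≥ 0`, `0 ≤ θ < 1` and leaf-12's (N1) `C ≥ 0` with, for ALL `k μ z` and ALL fine′ sites `u′`,
`|λ_{k+1} u′ − (Lc^4)⁻¹·λ_k (blk Lc u′)| ≤ (16·Lc·c·θ^k·(Lc^{5(k+2)})⁻¹·Lc^{k+1} + 8·Lc·C·(Lc^{5(k+2)})⁻¹)·e^{−κ‖quo (Lc^(k+2)) u′ − z‖∞}`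
— the (α)+(δ) letter of `CT4-DESIGN-v0` §2 POINTWISE: the `hdψ`∕`hdW` slot of leaf-02 g50's `abs_refine3_le` ∕ `abs_refine3_tip_le` for site weights (native currency; the consumer
multiplies by the unit `N′^4 = (Lc^{k+2})^4`). -/
theorem exists_gauge_refine_site_three (hLc : 2 ≤ Lc) :
    ∃ c C θ κ : ℝ, 0 ≤ c ∧ 0 ≤ C ∧ 0 ≤ θ ∧ θ < 1 ∧ 0 < κ ∧
      ∀ (rr : Fin (3 + 1) → ℕ), rr ∈ box (3 + 1) Lc → ∀ (k : ℕ) (μ : Fin (3 + 1)) (z u' : Site (3 + 1)),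
        |(Psi (toSite rr) Lc 0 (k + 1) (delta1 μ z) u' - bmGaugeAt (toSite rr) (respStep (d := 3) 1 (Lc ^ (k + 2)) μ z) Lc u')
            - ((Lc : ℝ) ^ (3 + 1))⁻¹ *
              (Psi (toSite rr) Lc 0 k (delta1 μ z) (blk Lc u')
                - bmGaugeAt (toSite rr) (respStep (d := 3) 1 (Lc ^ (k + 1)) μ z) Lc (blk Lc u'))|
          ≤ (16 * (Lc : ℝ) * c * θ ^ k * ((Lc : ℝ) ^ (5 * (k + 2)))⁻¹ * (Lc : ℝ) ^ (k + 1)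
              + 8 * (Lc : ℝ) * C * ((Lc : ℝ) ^ (5 * (k + 2)))⁻¹) *
            Real.exp (-(κ * supNorm (quo (Lc ^ (k + 2)) u' - z))) := by
  obtain ⟨κ, C, c, θ, hκ, hC, hc, hθ0, hθ1, H⟩ := ContactGaugeStaircaseCauchyPack.exists_gauge_staircase_cauchy (Lc := Lc) hLc
  refine ⟨c, C, θ, κ, hc, hC, hθ0, hθ1, hκ, fun rr hrr k μ z u' => ?_⟩
  obtain ⟨-, -, -, -, hid, hlet⟩ := H rr hrr k μ z
  rw [hid u']
  refine (Finset.abs_sum_le_sum_abs _ _).trans ?_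
  refine (Finset.sum_le_sum fun s' hs' => hlet s' (by have h := Finset.mem_range.1 hs'; omega) u').trans ?_
  rw [← Finset.sum_mul]
  have hB : 0 ≤ 8 * (Lc : ℝ) * (c * θ ^ k) * ((Lc : ℝ) ^ (5 * (k + 2)))⁻¹ := by positivity
  refine (mul_le_mul_of_nonneg_right (sum_pieceLetters_le hLc (8 * (Lc : ℝ) * C * ((Lc : ℝ) ^ (5 * (k + 2)))⁻¹) hB k)
    (Real.exp_pos _).le).trans (le_of_eq ?_)
  ring

end Summit.QuantumFields.BalabanUV.Beta.GAN24.ContactGaugeRefine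

end
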